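import Mathlib.Analysis.Calculus.FDeriv.Mul
import Literature.Analysis.FluidPDE.LagrangianFieldBounded
import Literature.Analysis.FluidPDE.SerrinEnstrophyGronwall
import HarnessLib

/-!
# A-priori estimates along particle trajectories in `B`: (4.44)–(4.47) of Majda–Bertozzi and
the Lipschitz bounds of the forward and backward flows

Analysis/FluidPDE support file (everything proved; no named facts) on the discharge path of
`Literature.Analysis.FluidPDE.MajdaBertozzi2002_particleTrajectoryAprioriBound`
(`HolderEulerContinuationProofs.lean`; A. J. Majda, A. L. Bertozzi, *Vorticity and Incompressible
Flow*, CUP 2002, §4.2 **Thm 4.3 (i)** via **Prop. 4.3**, p. 131–134 of the held text). For a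
volume-preserving bijective solution `X ∈ C¹([0, T); B)` of the particle-trajectory equations
(4.8)–(4.9) (`IsParticleTrajectorySolution γ (Ico 0 T) ω₀ X`, `HolderEulerLagrangian.lean`) with
a compactly supported `γ`-Hölder Lagrangian vorticity `ω₀`, `0 < γ < 1`, this file renders the
first half of the printed proof of Prop. 4.3 (p. 133):

* **(4.44)** "`(d/dt) X(α, t) = v(X(α, t), t)`, `v(x, t) = ∫ K₃[x − X(α′,t)] ∇_αX(α′,t) ω₀(α′) dα′`":
  the Eulerian velocity `v(·, t) = lagrangianVelocity ω₀ X(t)` is `C¹` (it is the Biot–Savart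
  velocity of the transported density, (4.37), `lagrangianVelocity_eq_biotSavart_pushforwardVorticity`,
  with the potential theory (4.39) of the tree) and `t ↦ X(α, t)`, `t ↦ ∇_αX(α, t)` are
  differentiable with **(4.45)** "`(d/dt) ∇_αX(α, t) = ∇v(X(α, t), t) ∇_αX(α, t)`"
  (`hasDerivAt_apply`, `hasDerivAt_fderiv_apply`; the evaluation maps `B → ℝ³`, `B → L(ℝ³)` are
  continuous linear), together with the equation for the inverse matrix,
  `(d/dt) (∇_αX)⁻¹ = −(∇_αX)⁻¹ ∇v(X, t)` (`hasDerivAt_inverse_fderiv_apply`);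
* **(4.46)** "`|X(0,t)| ≤ ∫₀ᵗ |v(·, s)|₀ ds`" in the form `‖X(α, t) − α‖ ≤ ∫₀ᵗ |v(·, s)|₀ ds`
  (`norm_apply_sub_self_le`);
* **(4.47)** "`|∇_αX(·, t)|₀ ≤ exp ∫₀ᵗ |∇v(·, s)|₀ ds`" (`norm_fderiv_le_exp`), its backward
  companion "`|∇X⁻¹(x, t−s)|₀ ≤ exp[∫ₛᵗ |∇v(s′,·)|₀ ds′]`" (p. 135–136) in the two forms
  `‖(∇_αX(α,t))⁻¹‖ ≤ exp ∫₀ᵗ |∇v|₀` (`norm_inverse_fderiv_le_exp`) and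
  `‖∇_αX(α,s) (∇_αX(α,t))⁻¹‖ ≤ exp ∫ₛᵗ |∇v|₀` (`norm_fderiv_comp_inverse_le_exp`), and the
  resulting Lipschitz bound of the backward flow `X(·,s) ∘ X(·,t)⁻¹`,
  `‖X(α,s) − X(β,s)‖ ≤ exp(∫ₛᵗ |∇v|₀) ‖X(α,t) − X(β,t)‖` (`norm_apply_sub_apply_le_exp`), which
  is how the Hölder quotients of the transported vorticity are pulled back in the proof of
  Lemma 4.8 (p. 135–136);
* the integral inequalities behind the Hölder bounds of `∇_αX` and of `∇_αX ω₀` (p. 134: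
  "`(d/dt)|∇_αX(·,t)|_γ ≤ |∇v(X(·,t),t)|_γ |∇_αX(·,t)|₀ + |∇v(·,t)|₀ |∇_αX(·,t)|_γ`"):
  `norm_fderiv_sub_fderiv_le_lintegral`, `norm_fderiv_apply_sub_le_lintegral`.

All "`|∇v(·, s)|₀`" are the real suprema `flowGradSup ω₀ X s` of `‖∇v(x, s)‖`, and all time
integrals are lower Lebesgue integrals `∫⁻_{(a,t)} ofReal`, so that no measurability in time is
ever needed; Grönwall's lemma is the tree's measurability-free `lintegral_gronwall_le`
(`SerrinEnstrophyGronwall.lean`), transported to real functions and to a general initial time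
(`real_gronwall_Icc`). The finiteness/boundedness side conditions on compact `[0, t₁] ⊂ [0, T)`
come from the membership `X(s) ∈ O_M`, `M = 1 + sup_{[0,t₁]} |X(s)|_{1,γ}` (volume preservation,
`mem_trajectoryOpenSet_of_det_eq_one`) and the bounds of `LagrangianDictionary.lean`,
`BiotSavartHolder.lean`, `BiotSavartBounds.lean`, uniform over `O_M`.

## Mathlib / tree search

Used from the tree: `IsParticleTrajectorySolution`, `lagrangianVelocity`, `lagrangianField`
(`HolderEulerLagrangian`), `C1HolderMap.fderivEvalCLM`, `C1HolderMap.evalCLM`, `trajectoryOpenSet`,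
`mem_trajectoryOpenSet_of_det_eq_one` (`HolderEulerTrajectoryContinuation`),
`lagrangianVelocity_eq_biotSavart_pushforwardVorticity`, `hasFDerivAt_invFun_of_det_fderiv_ne_zero`
(`HolderEulerVolumePreserving`), `pushforwardVorticity_eq_lagrangianPushforward`,
`holderWith_lagrangianPushforward`, `norm_lagrangianPushforward_le`,
`tsupport_lagrangianPushforward_subset`, `norm_inverse_fderiv_le`, `bijective_of_mem`,
`invFun_apply_of_mem` (`LagrangianDictionary`), `exists_data_of_memHolder` (`LagrangianFieldBounded`),
`contDiff_biotSavart` (`BiotSavartGradient`), `exists_norm_fderiv_biotSavart_le` (`BiotSavartHolder`),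
`norm_biotSavart_le_of_support_subset` (`BiotSavartBounds`), `lintegral_gronwall_le`,
`lintegral_Ioo_eq_lintegral_Ioc` (`SerrinEnstrophyGronwall`). Mathlib: `hasFDerivAt_ringInverse`,
`ContinuousLinearMap.ringInverse_eq_inverse`, `NormedRing.inverse_continuousAt`,
`intervalIntegral.integral_eq_sub_of_hasDerivAt_of_le`, `norm_integral_le_lintegral_norm`,
`Convex.norm_image_sub_le_of_norm_hasFDerivWithin_le`, `lintegral_add_left_eq_self`.

## References

* A. J. Majda, A. L. Bertozzi, *Vorticity and Incompressible Flow* (CUP 2002), §4.2 Prop. 4.3,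
  (4.44)–(4.47) (p. 133–134), proof of Lemma 4.8 (p. 135–136). [MajdaBertozziCUP2002]
-/

noncomputable section

open MeasureTheory Set Function Filter TopologicalSpace Metric
open _root_.Topology
open scoped NNReal ENNReal

namespace Literature.Analysis.FluidPDE

open FunctionSpaces

/-! ### Generic tools: shifted lower integrals, Grönwall from an initial time, the integral
inequality of a differentiable curve -/

section Tools

/-- Shift of a lower integral over an interval: `∫_{(0,r)} f(a + x) dx = ∫_{(a, a+r)} f`. [folklore] -/
theorem lintegral_Ioo_comp_add_left (f : ℝ → ℝ≥0∞) (a r : ℝ) :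
    ∫⁻ x in Ioo 0 r, f (a + x) = ∫⁻ x in Ioo a (a + r), f x := by
  rw [← lintegral_indicator measurableSet_Ioo, ← lintegral_indicator measurableSet_Ioo,
    ← lintegral_add_left_eq_self ((Ioo a (a + r)).indicator f) a]
  congr 1
  funext x
  have hmem : x ∈ Ioo 0 r ↔ a + x ∈ Ioo a (a + r) := by
    simp only [mem_Ioo]
    constructor <;> intro h <;> constructor <;> linarith [h.1, h.2]
  by_cases hx : x ∈ Ioo 0 r
  · rw [indicator_of_mem hx, indicator_of_mem (hmem.1 hx)]
  · rw [indicator_of_notMem hx, indicator_of_notMem fun h => hx (hmem.2 h)]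

/-- **Grönwall's lemma in integral form, real-valued, from an initial time `a`, with an
integrable kernel and no measurability**: if `u ≤ B` and `0 ≤ κ` on `[a, b]`,
`∫_{(a,b)} κ < ∞` (lower integral), `0 ≤ c`, and
`u(t) ≤ c + ∫_{(a,t)} κ u` for all `t ∈ [a, b]`, then `u(t) ≤ c exp(∫_{(a,t)} κ)` on `[a, b]`
(Majda–Bertozzi Lemma 4.7; the tree's `lintegral_gronwall_le` shifted by `a`). [cite: MajdaBertozziCUP2002, §4.2 Lemma 4.7 (p. 133)] -/
theorem real_gronwall_Icc {a b : ℝ} {u κ : ℝ → ℝ} {c B : ℝ} (hc : 0 ≤ c)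
    (huB : ∀ t ∈ Icc a b, u t ≤ B) (hκ0 : ∀ t ∈ Icc a b, 0 ≤ κ t)
    (hκfin : ∫⁻ t in Ioo a b, ENNReal.ofReal (κ t) ≠ ∞)
    (h : ∀ t ∈ Icc a b, u t ≤ c + (∫⁻ s in Ioo a t, ENNReal.ofReal (κ s * u s)).toReal) :
    ∀ t ∈ Icc a b, u t ≤ c * Real.exp ((∫⁻ s in Ioo a t, ENNReal.ofReal (κ s)).toReal) := by
  intro t ht
  -- shifted functions on `[0, b - a]`
  set φ : ℝ → ℝ≥0∞ := fun r => ENNReal.ofReal (u (a + r)) with hφ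
  set α : ℝ → ℝ≥0∞ := fun r => ENNReal.ofReal (κ (a + r)) with hα
  have hshift : ∀ r, ∫⁻ s in Ioo 0 r, α s * φ s =
      ∫⁻ s in Ioo a (a + r), ENNReal.ofReal (κ s) * ENNReal.ofReal (u s) := fun r =>
    lintegral_Ioo_comp_add_left (fun s => ENNReal.ofReal (κ s) * ENNReal.ofReal (u s)) a r
  have hshiftα : ∀ r, ∫⁻ s in Ioo 0 r, α s = ∫⁻ s in Ioo a (a + r), ENNReal.ofReal (κ s) := fun r =>
    lintegral_Ioo_comp_add_left (fun s => ENNReal.ofReal (κ s)) a r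
  have hφM : ∀ r ∈ Icc 0 (b - a), φ r ≤ ENNReal.ofReal B := fun r hr =>
    ENNReal.ofReal_le_ofReal (huB (a + r) ⟨by linarith [hr.1], by linarith [hr.2]⟩)
  have hαfin : ∫⁻ r in Ioo 0 (b - a), α r ≠ ∞ := by
    rw [hshiftα, show a + (b - a) = b by ring]
    exact hκfin
  have hineq : ∀ r ∈ Icc 0 (b - a), φ r ≤ ENNReal.ofReal c + ∫⁻ s in Ioo 0 r, α s * φ s := by
    intro r hr
    have har : a + r ∈ Icc a b := ⟨by linarith [hr.1], by linarith [hr.2]⟩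
    rw [hshift]
    calc φ r = ENNReal.ofReal (u (a + r)) := rfl
      _ ≤ ENNReal.ofReal (c + (∫⁻ s in Ioo a (a + r), ENNReal.ofReal (κ s * u s)).toReal) :=
          ENNReal.ofReal_le_ofReal (h (a + r) har)
      _ ≤ ENNReal.ofReal c + ENNReal.ofReal ((∫⁻ s in Ioo a (a + r), ENNReal.ofReal (κ s * u s)).toReal) :=
          ENNReal.ofReal_add_le
      _ ≤ ENNReal.ofReal c + ∫⁻ s in Ioo a (a + r), ENNReal.ofReal (κ s * u s) :=
          add_le_add le_rfl ENNReal.ofReal_toReal_le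
      _ = ENNReal.ofReal c + ∫⁻ s in Ioo a (a + r), ENNReal.ofReal (κ s) * ENNReal.ofReal (u s) := by
          congr 1
          refine setLIntegral_congr_fun measurableSet_Ioo fun s hs => ?_
          rw [ENNReal.ofReal_mul (hκ0 s ⟨hs.1.le, by linarith [hs.2, hr.2]⟩)]
  have hG := lintegral_gronwall_le (S := b - a) ENNReal.ofReal_ne_top ENNReal.ofReal_ne_top hφM hαfin
    hineq (t - a) ⟨by linarith [ht.1], by linarith [ht.2]⟩
  rw [hshiftα, show a + (t - a) = t by ring] at hG
  have hφt : φ (t - a) = ENNReal.ofReal (u t) := by simp [hφ]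
  rw [hφt, ← ENNReal.ofReal_mul hc] at hG
  exact (ENNReal.ofReal_le_ofReal_iff (mul_nonneg hc (Real.exp_pos _).le)).1 hG

variable {F : Type*} [NormedAddCommGroup F] [NormedSpace ℝ F] [CompleteSpace F]

/-- **The integral inequality of a differentiable curve, in lower-integral form**: if `M` is
continuous on `[a, t]`, differentiable on `(a, t)` with derivative `M'`, `M'` interval
integrable, and `‖M'(s)‖ ≤ g(s)` on `(a, t)`, then
`‖M(t)‖ ≤ ‖M(a)‖ + ∫_{(a,t)} g` (the fundamental theorem of calculus and
`‖∫ f‖ ≤ ∫⁻ ‖f‖`; no measurability of `g`). [folklore] -/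
theorem norm_le_norm_add_toReal_lintegral_of_hasDerivAt {M M' : ℝ → F} {a t : ℝ} (hat : a ≤ t)
    (hcont : ContinuousOn M (Icc a t)) (hderiv : ∀ s ∈ Ioo a t, HasDerivAt M (M' s) s)
    (hint : IntervalIntegrable M' volume a t) {g : ℝ → ℝ} (hg : ∀ s ∈ Ioo a t, ‖M' s‖ ≤ g s)
    (hgfin : ∫⁻ s in Ioo a t, ENNReal.ofReal (g s) ≠ ∞) :
    ‖M t‖ ≤ ‖M a‖ + (∫⁻ s in Ioo a t, ENNReal.ofReal (g s)).toReal := by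
  have hftc := intervalIntegral.integral_eq_sub_of_hasDerivAt_of_le hat hcont hderiv hint
  have hMt : M t = M a + ∫ s in a..t, M' s := by rw [hftc]; abel
  have h1 : ‖∫ s in a..t, M' s‖ ≤ (∫⁻ s in Ioo a t, ENNReal.ofReal (g s)).toReal := by
    rw [intervalIntegral.integral_of_le hat]
    refine (norm_integral_le_lintegral_norm _).trans ?_
    rw [← lintegral_Ioo_eq_lintegral_Ioc]
    refine ENNReal.toReal_mono hgfin (setLIntegral_mono' measurableSet_Ioo fun s hs => ?_)
    exact ENNReal.ofReal_le_ofReal (hg s hs)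
  calc ‖M t‖ = ‖M a + ∫ s in a..t, M' s‖ := by rw [hMt]
    _ ≤ ‖M a‖ + ‖∫ s in a..t, M' s‖ := norm_add_le _ _
    _ ≤ ‖M a‖ + (∫⁻ s in Ioo a t, ENNReal.ofReal (g s)).toReal := add_le_add le_rfl h1

/-- A lower integral of `ofReal g` over `(a, t)` is finite when `g` is bounded above there.
[folklore] -/
theorem lintegral_Ioo_ofReal_ne_top_of_le {g : ℝ → ℝ} {a t B : ℝ} (hg : ∀ s ∈ Ioo a t, g s ≤ B) :
    ∫⁻ s in Ioo a t, ENNReal.ofReal (g s) ≠ ∞ := by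
  refine ne_top_of_le_ne_top (b := ∫⁻ _ in Ioo a t, ENNReal.ofReal B) ?_
    (setLIntegral_mono' measurableSet_Ioo fun s hs => ENNReal.ofReal_le_ofReal (hg s hs))
  rw [setLIntegral_const]
  exact ENNReal.mul_ne_top ENNReal.ofReal_ne_top (measure_Ioo_lt_top.ne)

/-- Monotonicity of `toReal ∫⁻_{(a,t)} ofReal` in the integrand, the larger one being bounded.
[folklore] -/
theorem toReal_lintegral_Ioo_mono {f g : ℝ → ℝ} {a t B : ℝ} (hfg : ∀ s ∈ Ioo a t, f s ≤ g s)
    (hg : ∀ s ∈ Ioo a t, g s ≤ B) :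
    (∫⁻ s in Ioo a t, ENNReal.ofReal (f s)).toReal ≤ (∫⁻ s in Ioo a t, ENNReal.ofReal (g s)).toReal :=
  ENNReal.toReal_mono (lintegral_Ioo_ofReal_ne_top_of_le hg)
    (setLIntegral_mono' measurableSet_Ioo fun s hs => ENNReal.ofReal_le_ofReal (hfg s hs))

/-- Splitting `∫_{(0,t)} = ∫_{(0,s)} + ∫_{(s,t)}` for lower integrals, `0 ≤ s ≤ t`. [folklore] -/
theorem lintegral_Ioo_eq_add {f : ℝ → ℝ≥0∞} {s t : ℝ} (hs : 0 ≤ s) (hst : s ≤ t) :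
    ∫⁻ r in Ioo 0 t, f r = (∫⁻ r in Ioo 0 s, f r) + ∫⁻ r in Ioo s t, f r := by
  rw [lintegral_Ioo_eq_lintegral_Ioc, lintegral_Ioo_eq_lintegral_Ioc, lintegral_Ioo_eq_lintegral_Ioc,
    lintegral_Ioc_add_Ioc hs hst]

end Tools

/-! ### Suprema as real numbers -/

section Sup

variable {ι : Type*} {F : Type*} [NormedAddCommGroup F] {f : ι → F} {B : ℝ}

/-- If `‖f‖ ≤ B` pointwise then `⨆ ‖f‖ₑ ≤ ofReal B < ∞`. [folklore] -/
theorem iSup_enorm_le_ofReal (hB : ∀ x, ‖f x‖ ≤ B) : (⨆ x, ‖f x‖ₑ) ≤ ENNReal.ofReal B :=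
  iSup_le fun x => by rw [← ofReal_norm]; exact ENNReal.ofReal_le_ofReal (hB x)

/-- The real supremum `(⨆ ‖f‖ₑ).toReal` dominates `‖f x‖` as soon as `f` is bounded. [folklore] -/
theorem norm_le_toReal_iSup_enorm (hB : ∀ x, ‖f x‖ ≤ B) (x : ι) : ‖f x‖ ≤ (⨆ x, ‖f x‖ₑ).toReal := by
  have htop : (⨆ x, ‖f x‖ₑ) ≠ ⊤ := ne_top_of_le_ne_top ENNReal.ofReal_ne_top (iSup_enorm_le_ofReal hB)
  rw [← ENNReal.ofReal_le_iff_le_toReal htop, ofReal_norm]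
  exact le_iSup (fun x => ‖f x‖ₑ) x

/-- The real supremum is at most any pointwise bound (for a nonempty index type). [folklore] -/
theorem toReal_iSup_enorm_le [Nonempty ι] (hB : ∀ x, ‖f x‖ ≤ B) : (⨆ x, ‖f x‖ₑ).toReal ≤ B := by
  have hB0 : 0 ≤ B := (norm_nonneg _).trans (hB (Classical.arbitrary ι))
  exact (ENNReal.toReal_mono ENNReal.ofReal_ne_top (iSup_enorm_le_ofReal hB)).trans
    (le_of_eq (ENNReal.toReal_ofReal hB0))

/-- `ofReal` of the real supremum is the supremum, for bounded `f`. [folklore] -/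
theorem ofReal_toReal_iSup_enorm (hB : ∀ x, ‖f x‖ ≤ B) :
    ENNReal.ofReal ((⨆ x, ‖f x‖ₑ).toReal) = ⨆ x, ‖f x‖ₑ :=
  ENNReal.ofReal_toReal (ne_top_of_le_ne_top ENNReal.ofReal_ne_top (iSup_enorm_le_ofReal hB))

end Sup

/-! ### The setting: a particle-trajectory solution on `[0, T)` -/

section Flow

/-- Local notation for physical space `ℝ³ = EuclideanSpace ℝ (Fin 3)`. -/
local notation "ℝ³" => EuclideanSpace ℝ (Fin 3)

variable {γ : ℝ≥0} {T : ℝ} {ω₀ : ℝ³ → ℝ³} {X : ℝ → C1HolderMap ℝ³ ℝ³ γ}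

/-- **`|∇v(·, s)|₀`**: the real supremum of `‖∇v(x, s)‖` for the Eulerian velocity (4.44)
`v(·, s) = lagrangianVelocity ω₀ X(s)` of a family of trajectory maps (the quantity
"`|∇v(·, s)|_0`" of Prop. 4.3 and Thm 4.3; finite for particle-trajectory solutions with Hölder
data, `norm_fderiv_lagrangianVelocity_le_flowGradSup`). [cite: MajdaBertozziCUP2002, §4.2 Prop. 4.3 (p. 133)] -/
def flowGradSup (ω₀ : ℝ³ → ℝ³) (X : ℝ → C1HolderMap ℝ³ ℝ³ γ) (s : ℝ) : ℝ :=
  (⨆ x, ‖fderiv ℝ (lagrangianVelocity ω₀ (X s)) x‖ₑ).toReal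

/-- **`∫ₐᵗ |∇v(·, s)|₀ ds`** as (the real value of) a lower Lebesgue integral — the exponent of
(4.47). [cite: MajdaBertozziCUP2002, §4.2 (4.47) (p. 133)] -/
def flowGradInt (ω₀ : ℝ³ → ℝ³) (X : ℝ → C1HolderMap ℝ³ ℝ³ γ) (a t : ℝ) : ℝ :=
  (∫⁻ s in Ioo a t, ENNReal.ofReal (flowGradSup ω₀ X s)).toReal

/-- `flowGradSup ≥ 0`. [folklore] -/
theorem flowGradSup_nonneg (ω₀ : ℝ³ → ℝ³) (X : ℝ → C1HolderMap ℝ³ ℝ³ γ) (s : ℝ) :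
    0 ≤ flowGradSup ω₀ X s := ENNReal.toReal_nonneg

/-- `flowGradInt ≥ 0`. [folklore] -/
theorem flowGradInt_nonneg (ω₀ : ℝ³ → ℝ³) (X : ℝ → C1HolderMap ℝ³ ℝ³ γ) (a t : ℝ) :
    0 ≤ flowGradInt ω₀ X a t := ENNReal.toReal_nonneg

namespace IsParticleTrajectorySolution

/-! #### Membership in `O_M` on compact time intervals -/

/-- **On compact `[0, t₁] ⊂ [0, T)` the trajectory maps stay in one `O_M`** (volume
preservation gives `det ∇_αX ≡ 1 > 1/2`, and `|X(·,s)|_{1,γ}` is bounded on compacts by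
continuity in `B`; p. 133). [cite: MajdaBertozziCUP2002, §4.2 (p. 133)] -/
theorem exists_mem_trajectoryOpenSet (hX : IsParticleTrajectorySolution γ (Ico 0 T) ω₀ X) {t₁ : ℝ}
    (ht₁ : t₁ < T) : ∃ M : ℝ, 1 ≤ M ∧ ∀ s ∈ Icc 0 t₁, X s ∈ trajectoryOpenSet γ M := by
  obtain ⟨C, hC⟩ := hX.exists_norm_le_of_isCompact isCompact_Icc (Icc_subset_Ico_right ht₁)
  refine ⟨max C 0 + 1, by linarith [le_max_right C 0], fun s hs =>
    mem_trajectoryOpenSet_of_det_eq_one (hX.volumePreserving s ⟨hs.1, hs.2.trans_lt ht₁⟩) ?_⟩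
  linarith [hC s hs, le_max_left C 0]

/-! #### The Eulerian velocity (4.44) of a solution: regularity and uniform bounds -/

variable (hγ : 0 < γ) (hγ1 : γ < 1) (hω : MemHolder γ ω₀) (hωc : HasCompactSupport ω₀)
  (hX : IsParticleTrajectorySolution γ (Ico 0 T) ω₀ X)
include hγ hω hωc hX

/-- **(4.44)/(4.37): the velocity of a solution is `C¹`** at every time of `[0, T)` (it is the
Biot–Savart velocity of the Hölder, compactly supported transported density; (4.39)). [cite: MajdaBertozziCUP2002, §4.1.3 (4.37)–(4.39) (p. 129) and §4.2 (4.44) (p. 133)] -/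
theorem contDiff_lagrangianVelocity {t : ℝ} (ht : t ∈ Ico 0 T) :
    ContDiff ℝ 1 (lagrangianVelocity ω₀ (X t)) := by
  have hbij := hX.bijective t ht
  have hdet := hX.volumePreserving t ht
  have hdet2 : ∀ a, 1 / 2 ≤ (fderiv ℝ (X t : ℝ³ → ℝ³) a).det := fun a => by rw [hdet a]; norm_num
  have hdetpos : ∀ a, 0 < (fderiv ℝ (X t : ℝ³ → ℝ³) a).det := fun a => by rw [hdet a]; exact one_pos
  obtain ⟨C, hC⟩ := exists_holderWith_pushforwardVorticity hγ (X t) hbij hdet2 hω hωc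
  rw [lagrangianVelocity_eq_biotSavart_pushforwardVorticity (X t).differentiable hbij hdetpos ω₀]
  exact contDiff_biotSavart hγ hC (hasCompactSupport_pushforwardVorticity (X t).continuous hbij.2 hωc)

include hγ1 in
/-- **Uniform bounds on compact time intervals** (the qualitative side conditions of the
a-priori estimates): on `[0, t₁] ⊂ [0, T)` the velocity gradients `‖∇v(x, s)‖`, the velocities
`‖v(x, s)‖`, the deformation gradients `‖∇_αX(α, s)‖` and their inverses `‖(∇_αX(α, s))⁻¹‖` are
bounded by one constant (from `X(s) ∈ O_M`, the uniform Hölder/sup/support bounds of the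
transported density over `O_M`, `LagrangianDictionary.lean`, the gradient bound (4.39)
`exists_norm_fderiv_biotSavart_le`, Lemma 4.5 `norm_biotSavart_le_of_support_subset`, and the
inverse bound `norm_inverse_fderiv_le`). [cite: MajdaBertozziCUP2002, §4.1.3 Lemma 4.5, (4.37)–(4.39) (p. 128–129)] -/
theorem exists_flow_bounds {t₁ : ℝ} (ht₁ : t₁ < T) :
    ∃ B : ℝ, 1 ≤ B ∧ ∀ s ∈ Icc 0 t₁,
      (∀ x, ‖fderiv ℝ (lagrangianVelocity ω₀ (X s)) x‖ ≤ B) ∧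
      (∀ x, ‖lagrangianVelocity ω₀ (X s) x‖ ≤ B) ∧
      (∀ a, ‖fderiv ℝ (X s : ℝ³ → ℝ³) a‖ ≤ B) ∧
      (∀ a, ‖(fderiv ℝ (X s : ℝ³ → ℝ³) a).inverse‖ ≤ B) := by
  have hγ1' : γ ≤ 1 := hγ1.le
  obtain ⟨M, hM1, hM⟩ := hX.exists_mem_trajectoryOpenSet ht₁
  have hM0 : 0 ≤ M := zero_le_one.trans hM1
  obtain ⟨Cw, R, Mw, hR, hw, hsupp, hMw⟩ := exists_data_of_memHolder hγ hω hωc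
  have hMw0 : 0 ≤ Mw := (norm_nonneg _).trans (hMw 0)
  obtain ⟨c, hc0, hc⟩ := exists_norm_fderiv_biotSavart_le hγ
  -- the uniform constants
  set CM : ℝ≥0 := Real.toNNReal (M * pushforwardHolderConst γ M Cw Mw) with hCM
  set B₁ : ℝ := c * (CM * (M * R) ^ (γ : ℝ) + 2 * M * Mw) with hB₁
  set B₂ : ℝ := 5 * (2 * M * Mw) * (M * R) with hB₂
  refine ⟨max 1 (max B₁ (max B₂ (max M (inverseBound M)))), le_max_left _ _, fun s hs => ?_⟩
  have hY := hM s hs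
  have hs' : s ∈ Ico 0 T := ⟨hs.1, hs.2.trans_lt ht₁⟩
  have hbij := hX.bijective s hs'
  have hdet := hX.volumePreserving s hs'
  have hdetpos : ∀ a, 0 < (fderiv ℝ (X s : ℝ³ → ℝ³) a).det := fun a => by rw [hdet a]; exact one_pos
  have hnorm : ‖X s‖ ≤ M := (norm_lt_of_mem_trajectoryOpenSet hY).le
  -- the transported density and its uniform data
  have hv : lagrangianVelocity ω₀ (X s) =
      biotSavart (lagrangianPushforward (X s : ℝ³ → ℝ³) (X s : ℝ³ → ℝ³) ω₀) := by
    rw [lagrangianVelocity_eq_biotSavart_pushforwardVorticity (X s).differentiable hbij hdetpos ω₀,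
      pushforwardVorticity_eq_lagrangianPushforward]
  have hfH := holderWith_lagrangianPushforward hγ hγ1' hY (X s) hw hMw
  have hfH' : HolderWith CM γ (lagrangianPushforward (X s : ℝ³ → ℝ³) (X s : ℝ³ → ℝ³) ω₀) := by
    refine hfH.mono ?_
    rw [hCM]
    exact Real.toNNReal_le_toNNReal (mul_le_mul_of_nonneg_right hnorm
      (pushforwardHolderConst_nonneg hM0 Cw.coe_nonneg hMw0))
  have hfM : ∀ x, ‖lagrangianPushforward (X s : ℝ³ → ℝ³) (X s : ℝ³ → ℝ³) ω₀ x‖ ≤ 2 * M * Mw :=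
    fun x => (norm_lagrangianPushforward_le hY (X s) hMw x).trans (by gcongr)
  have hfs := tsupport_lagrangianPushforward_subset hγ hγ1' hY (X s) hsupp
  have hMR : 0 < M * R := mul_pos (zero_lt_one.trans_le hM1) hR
  refine ⟨fun x => ?_, fun x => ?_, fun a => ?_, fun a => ?_⟩
  · rw [hv]
    refine (hc _ CM _ _ _ hMR hfH' hfs hfM x).trans ?_
    exact (le_max_left _ _).trans (le_max_right _ _)
  · rw [hv]
    refine (norm_biotSavart_le_of_support_subset hMR hfM
      ((subset_tsupport _).trans hfs) x).trans ?_
    exact (le_max_left _ _).trans ((le_max_right _ _).trans (le_max_right _ _))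
  · exact ((X s).norm_fderiv_le a).trans (hnorm.trans
      ((le_max_left _ _).trans ((le_max_right _ _).trans ((le_max_right _ _).trans
        (le_max_right _ _)))))
  · exact (norm_inverse_fderiv_le hY a).trans
      ((le_max_right _ _).trans ((le_max_right _ _).trans ((le_max_right _ _).trans
        (le_max_right _ _))))

include hγ1 in
/-- **`|∇v(·, s)|₀` is a genuine supremum**: `‖∇v(x, s)‖ ≤ flowGradSup ω₀ X s` for `s ∈ [0, T)`.
[cite: MajdaBertozziCUP2002, §4.2 Prop. 4.3 (p. 133)] -/
theorem norm_fderiv_lagrangianVelocity_le_flowGradSup {s : ℝ} (hs : s ∈ Ico 0 T) (x : ℝ³) :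
    ‖fderiv ℝ (lagrangianVelocity ω₀ (X s)) x‖ ≤ flowGradSup ω₀ X s := by
  obtain ⟨B, -, hB⟩ := hX.exists_flow_bounds hγ hγ1 hω hωc hs.2
  exact norm_le_toReal_iSup_enorm (hB s ⟨hs.1, le_rfl⟩).1 x

include hγ1 in
/-- `|∇v(·, s)|₀` is bounded on compact `[0, t₁] ⊂ [0, T)`. [folklore] -/
theorem exists_flowGradSup_le {t₁ : ℝ} (ht₁ : t₁ < T) :
    ∃ B : ℝ, 1 ≤ B ∧ ∀ s ∈ Icc 0 t₁, flowGradSup ω₀ X s ≤ B := by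
  obtain ⟨B, hB1, hB⟩ := hX.exists_flow_bounds hγ hγ1 hω hωc ht₁
  exact ⟨B, hB1, fun s hs => toReal_iSup_enorm_le (hB s hs).1⟩

include hγ1 in
/-- `∫_{(a,t₁)} |∇v(·, s)|₀ ds < ∞` for `0 ≤ a`, `t₁ < T`. [folklore] -/
theorem lintegral_flowGradSup_ne_top {a t₁ : ℝ} (ha : 0 ≤ a) (ht₁ : t₁ < T) :
    ∫⁻ s in Ioo a t₁, ENNReal.ofReal (flowGradSup ω₀ X s) ≠ ∞ := by
  obtain ⟨B, -, hB⟩ := hX.exists_flowGradSup_le hγ hγ1 hω hωc ht₁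
  exact lintegral_Ioo_ofReal_ne_top_of_le fun s hs => hB s ⟨ha.trans hs.1.le, hs.2.le⟩

include hγ1 in
/-- Additivity of the exponent: `∫₀ᵗ = ∫₀ˢ + ∫ₛᵗ` (`0 ≤ s ≤ t < T`). [folklore] -/
theorem flowGradInt_eq_add {s t : ℝ} (hs : 0 ≤ s) (hst : s ≤ t) (ht : t < T) :
    flowGradInt ω₀ X 0 t = flowGradInt ω₀ X 0 s + flowGradInt ω₀ X s t := by
  unfold flowGradInt
  rw [lintegral_Ioo_eq_add hs hst, ENNReal.toReal_add]
  · exact hX.lintegral_flowGradSup_ne_top hγ hγ1 hω hωc le_rfl (hst.trans_lt ht)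
  · exact hX.lintegral_flowGradSup_ne_top hγ hγ1 hω hωc hs ht

/-! #### (4.44)–(4.45): the label-wise ODEs -/

omit hγ hω hωc in
/-- **(4.44)** "`(d/dt) X(α, t) = v(X(α, t), t)`": at interior times each label trajectory is
differentiable with derivative the Eulerian velocity at its position (evaluation `B → ℝ³` is a
continuous linear map; `F(X)(α) = v(X(α))`, (4.3)). [cite: MajdaBertozziCUP2002, §4.2 (4.44) (p. 133) and §4.1 (4.3), (4.8) (p. 123–124)] -/
theorem hasDerivAt_apply {t : ℝ} (ht : t ∈ Ioo 0 T) (α : ℝ³) :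
    HasDerivAt (fun s => X s α) (lagrangianVelocity ω₀ (X t) (X t α)) t := by
  obtain ⟨X', -, hd, hF⟩ := hX.hasDeriv
  have ht' : t ∈ Ico 0 T := ⟨ht.1.le, ht.2⟩
  have h1 : HasDerivWithinAt (fun s => C1HolderMap.evalCLM α (X s))
      (C1HolderMap.evalCLM α (X' t)) (Ico 0 T) t :=
    (C1HolderMap.evalCLM α).hasFDerivAt.comp_hasDerivWithinAt t (hd t ht')
  simp only [C1HolderMap.evalCLM_apply] at h1
  rw [hF t ht' α] at h1
  exact h1.hasDerivAt (Ico_mem_nhds ht.1 ht.2)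

omit hγ hω hωc hX in
/-- The derivative curve read as functions: `dX/dt(s) = v(·, s) ∘ X(s)` ((4.3)/(4.26)). [cite: MajdaBertozziCUP2002, §4.1 (4.3), (4.26) (p. 123–128)] -/
theorem coe_deriv_eq {X' : ℝ → C1HolderMap ℝ³ ℝ³ γ} {S : Set ℝ}
    (hF : ∀ t ∈ S, ∀ α, X' t α = lagrangianField ω₀ (X t) α) {t : ℝ} (ht : t ∈ S) :
    (X' t : ℝ³ → ℝ³) = lagrangianVelocity ω₀ (X t) ∘ (X t : ℝ³ → ℝ³) :=
  funext fun α => hF t ht α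

omit hγ hω hωc hX in
/-- **(4.45)** "`(d/dt) ∇_αX(α, t) = ∇v(X(α, t), t) ∇_αX(α, t)`" for the derivative curve:
`∇[dX/dt(s)](α) = ∇v(X(α,s),s) ∇_αX(α,s)` (chain rule, `v(·, s) ∈ C¹`). [cite: MajdaBertozziCUP2002, §4.2 (4.45) (p. 133)] -/
theorem fderiv_deriv_apply {X' : ℝ → C1HolderMap ℝ³ ℝ³ γ} {S : Set ℝ}
    (hF : ∀ t ∈ S, ∀ α, X' t α = lagrangianField ω₀ (X t) α) {t : ℝ} (ht : t ∈ S)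
    (hv : ContDiff ℝ 1 (lagrangianVelocity ω₀ (X t))) (α : ℝ³) :
    fderiv ℝ (X' t : ℝ³ → ℝ³) α =
      (fderiv ℝ (lagrangianVelocity ω₀ (X t)) (X t α)).comp (fderiv ℝ (X t : ℝ³ → ℝ³) α) := by
  rw [coe_deriv_eq hF ht]
  exact fderiv_comp α ((hv.differentiable one_ne_zero) _) ((X t).differentiable α)

omit hγ hω hωc hX in
/-- `t ↦ ∇_αX(α, t)` is differentiable within the time set with derivative `∇[dX/dt(t)](α)`
(evaluation of the derivative, `B → L(ℝ³)`, is a continuous linear map). [folklore] -/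
theorem hasDerivWithinAt_fderiv_apply {X' : ℝ → C1HolderMap ℝ³ ℝ³ γ} {S : Set ℝ} {t : ℝ}
    (hd : HasDerivWithinAt X (X' t) S t) (α : ℝ³) :
    HasDerivWithinAt (fun s => fderiv ℝ (X s : ℝ³ → ℝ³) α) (fderiv ℝ (X' t : ℝ³ → ℝ³) α) S t := by
  have h := (C1HolderMap.fderivEvalCLM (r := γ) (F := ℝ³) α).hasFDerivAt.comp_hasDerivWithinAt t hd
  simpa [Function.comp_def] using h

/-- **(4.45) along a solution**: at interior times, `t ↦ ∇_αX(α, t)` is differentiable with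
derivative `∇v(X(α,t),t) ∘ ∇_αX(α,t)`. [cite: MajdaBertozziCUP2002, §4.2 (4.45) (p. 133)] -/
theorem hasDerivAt_fderiv_apply {t : ℝ} (ht : t ∈ Ioo 0 T) (α : ℝ³) :
    HasDerivAt (fun s => fderiv ℝ (X s : ℝ³ → ℝ³) α)
      ((fderiv ℝ (lagrangianVelocity ω₀ (X t)) (X t α)).comp (fderiv ℝ (X t : ℝ³ → ℝ³) α)) t := by
  obtain ⟨X', -, hd, hF⟩ := hX.hasDeriv
  have ht' : t ∈ Ico 0 T := ⟨ht.1.le, ht.2⟩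
  have h := (hasDerivWithinAt_fderiv_apply (hd t ht') α).hasDerivAt (Ico_mem_nhds ht.1 ht.2)
  rwa [fderiv_deriv_apply hF ht' (hX.contDiff_lagrangianVelocity hγ hω hωc ht') α] at h

/-! #### (4.47) and its backward companions by Grönwall -/

include hγ1 in
/-- **(4.47)** "`|∇_αX(·, t)|₀ ≤ exp ∫₀ᵗ |∇v(·, s)|₀ ds`" (from (4.45):
`‖∇_αX(α,t)‖ ≤ ‖I‖ + ∫₀ᵗ |∇v(·,s)|₀ ‖∇_αX(α,s)‖ ds` and Grönwall's lemma, Lemma 4.7; "Bound (4.47)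
is the simplest example of a Grönwall inequality"). [cite: MajdaBertozziCUP2002, §4.2 (4.47) and Lemma 4.7 (p. 133)] -/
theorem norm_fderiv_le_exp {t : ℝ} (ht : t ∈ Ico 0 T) (α : ℝ³) :
    ‖fderiv ℝ (X t : ℝ³ → ℝ³) α‖ ≤ Real.exp (flowGradInt ω₀ X 0 t) := by
  obtain ⟨X', hc, hd, hF⟩ := hX.hasDeriv
  obtain ⟨B, hB1, hB⟩ := hX.exists_flow_bounds hγ hγ1 hω hωc ht.2
  -- the curve `M(s) = ∇_αX(α, s)` and its derivative `∇[dX/dt(s)](α)`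
  set Mf : ℝ → ℝ³ →L[ℝ] ℝ³ := fun s => fderiv ℝ (X s : ℝ³ → ℝ³) α with hMf
  set Mf' : ℝ → ℝ³ →L[ℝ] ℝ³ := fun s => fderiv ℝ (X' s : ℝ³ → ℝ³) α with hMf'
  have hMc : ContinuousOn Mf (Icc 0 t) :=
    (C1HolderMap.continuous_fderiv_apply α).comp_continuousOn
      (hX.continuousOn.mono (Icc_subset_Ico_right ht.2))
  have hM'c : ContinuousOn Mf' (Icc 0 t) :=
    (C1HolderMap.continuous_fderiv_apply α).comp_continuousOn (hc.mono (Icc_subset_Ico_right ht.2))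
  have hMd : ∀ s ∈ Ioo 0 t, HasDerivAt Mf (Mf' s) s := fun s hs =>
    (hasDerivWithinAt_fderiv_apply (hd s ⟨hs.1.le, hs.2.trans ht.2⟩) α).hasDerivAt
      (Ico_mem_nhds hs.1 (hs.2.trans ht.2))
  have h0 : ‖Mf 0‖ ≤ 1 := by
    simp only [hMf, hX.initial, fderiv_id]
    exact ContinuousLinearMap.norm_id_le
  -- the integral inequality on every `[0, t']`, `t' ≤ t`
  have hineq : ∀ t' ∈ Icc 0 t, ‖Mf t'‖ ≤
      1 + (∫⁻ s in Ioo 0 t', ENNReal.ofReal (flowGradSup ω₀ X s * ‖Mf s‖)).toReal := by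
    intro t' ht'
    refine (norm_le_norm_add_toReal_lintegral_of_hasDerivAt ht'.1
      (hMc.mono (Icc_subset_Icc_right ht'.2)) (fun s hs => hMd s ⟨hs.1, hs.2.trans_le ht'.2⟩)
      ((hM'c.mono (Icc_subset_Icc_right ht'.2)).intervalIntegrable_of_Icc ht'.1)
      (g := fun s => flowGradSup ω₀ X s * ‖Mf s‖) (fun s hs => ?_) ?_).trans
      (add_le_add h0 le_rfl)
    · have hs' : s ∈ Ico 0 T := ⟨hs.1.le, lt_trans (hs.2.trans_le ht'.2) ht.2⟩
      show ‖fderiv ℝ (X' s : ℝ³ → ℝ³) α‖ ≤ flowGradSup ω₀ X s * ‖fderiv ℝ (X s : ℝ³ → ℝ³) α‖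
      rw [fderiv_deriv_apply hF hs' (hX.contDiff_lagrangianVelocity hγ hω hωc hs') α]
      exact (ContinuousLinearMap.opNorm_comp_le _ _).trans (mul_le_mul_of_nonneg_right
        (hX.norm_fderiv_lagrangianVelocity_le_flowGradSup hγ hγ1 hω hωc hs' _) (norm_nonneg _))
    · refine lintegral_Ioo_ofReal_ne_top_of_le (B := B * B) fun s hs => ?_
      have hs' : s ∈ Icc 0 t := ⟨hs.1.le, hs.2.le.trans ht'.2⟩
      exact mul_le_mul (toReal_iSup_enorm_le (hB s hs').1) ((hB s hs').2.2.1 α) (norm_nonneg _)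
        (zero_le_one.trans hB1)
  have key := real_gronwall_Icc (u := fun s => ‖Mf s‖) (κ := flowGradSup ω₀ X) zero_le_one
    (fun s hs => (hB s hs).2.2.1 α) (fun s _ => flowGradSup_nonneg ω₀ X s)
    (hX.lintegral_flowGradSup_ne_top hγ hγ1 hω hωc le_rfl ht.2) hineq t ⟨ht.1, le_rfl⟩
  rw [one_mul] at key
  exact key

omit hγ hω hωc in
/-- The deformation gradients of a solution are units of `L(ℝ³)` (`det ∇_αX ≡ 1`). [folklore] -/
theorem isUnit_fderiv {s : ℝ} (hs : s ∈ Ico 0 T) (α : ℝ³) :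
    IsUnit (fderiv ℝ (X s : ℝ³ → ℝ³) α) := by
  have hdet : (fderiv ℝ (X s : ℝ³ → ℝ³) α).det ≠ 0 := by
    rw [hX.volumePreserving s hs α]; exact one_ne_zero
  exact ⟨((fderiv ℝ (X s : ℝ³ → ℝ³) α).toContinuousLinearEquivOfDetNeZero hdet).toUnit,
    ContinuousLinearMap.coe_toContinuousLinearEquivOfDetNeZero _ _⟩

omit hγ hω hωc hX in
/-- The derivative of `s ↦ (∇_αX(α,s))⁻¹` from that of `s ↦ ∇_αX(α,s)`:
`(M⁻¹)' = −M⁻¹ M' M⁻¹` (Mathlib `hasFDerivAt_ringInverse`). [folklore] -/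
theorem hasDerivAt_ringInverse_comp {Mf : ℝ → ℝ³ →L[ℝ] ℝ³} {Mf' : ℝ³ →L[ℝ] ℝ³} {s : ℝ}
    (hMd : HasDerivAt Mf Mf' s) (hu : IsUnit (Mf s)) :
    HasDerivAt (fun τ => Ring.inverse (Mf τ))
      (-(Ring.inverse (Mf s) * Mf' * Ring.inverse (Mf s))) s := by
  obtain ⟨u, hu⟩ := hu
  have key := hasFDerivAt_ringInverse (𝕜 := ℝ) u
  rw [← Ring.inverse_unit u, hu] at key
  have h := key.comp_hasDerivAt s hMd
  simp only [neg_apply, ContinuousLinearMap.mulLeftRight_apply] at h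
  exact h

include hγ1 in
/-- **Backward (4.47) for the inverse deformation gradient**:
`‖(∇_αX(α,t))⁻¹‖ ≤ exp ∫₀ᵗ |∇v(·,s)|₀ ds` (p. 136: "`∇ₓX⁻¹` satisfies
`|∇X⁻¹(x,t−s)|₀ ≤ exp[∫ₛᵗ |∇v(s′,·)|₀ ds′]`", here `s = 0`; from
`(d/dt)(∇_αX)⁻¹ = −(∇_αX)⁻¹ ∇v(X,t)` and Grönwall). [cite: MajdaBertozziCUP2002, §4.2 proof of Lemma 4.8 (p. 136)] -/
theorem norm_inverse_fderiv_le_exp {t : ℝ} (ht : t ∈ Ico 0 T) (α : ℝ³) :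
    ‖(fderiv ℝ (X t : ℝ³ → ℝ³) α).inverse‖ ≤ Real.exp (flowGradInt ω₀ X 0 t) := by
  obtain ⟨X', hc, hd, hF⟩ := hX.hasDeriv
  obtain ⟨B, hB1, hB⟩ := hX.exists_flow_bounds hγ hγ1 hω hωc ht.2
  set Mf : ℝ → ℝ³ →L[ℝ] ℝ³ := fun s => fderiv ℝ (X s : ℝ³ → ℝ³) α with hMf
  set Mf' : ℝ → ℝ³ →L[ℝ] ℝ³ := fun s => fderiv ℝ (X' s : ℝ³ → ℝ³) α with hMf'
  set N : ℝ → ℝ³ →L[ℝ] ℝ³ := fun s => Ring.inverse (Mf s) with hN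
  have hNinv : ∀ s, N s = (Mf s).inverse := fun s => by
    rw [hN]; simp only; rw [ContinuousLinearMap.ringInverse_eq_inverse]
  have hMc : ContinuousOn Mf (Icc 0 t) :=
    (C1HolderMap.continuous_fderiv_apply α).comp_continuousOn
      (hX.continuousOn.mono (Icc_subset_Ico_right ht.2))
  have hM'c : ContinuousOn Mf' (Icc 0 t) :=
    (C1HolderMap.continuous_fderiv_apply α).comp_continuousOn (hc.mono (Icc_subset_Ico_right ht.2))
  have hMd : ∀ s ∈ Ioo 0 t, HasDerivAt Mf (Mf' s) s := fun s hs =>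
    (hasDerivWithinAt_fderiv_apply (hd s ⟨hs.1.le, hs.2.trans ht.2⟩) α).hasDerivAt
      (Ico_mem_nhds hs.1 (hs.2.trans ht.2))
  have hunit : ∀ s ∈ Icc 0 t, IsUnit (Mf s) := fun s hs => hX.isUnit_fderiv ⟨hs.1, hs.2.trans_lt ht.2⟩ α
  -- continuity and derivative of `N = M⁻¹`
  have hNc : ContinuousOn N (Icc 0 t) := by
    intro s hs
    obtain ⟨u, hu⟩ := hunit s hs
    have h1 : ContinuousAt Ring.inverse (Mf s) := hu ▸ NormedRing.inverse_continuousAt u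
    exact h1.comp_continuousWithinAt (hMc s hs)
  have hNd : ∀ s ∈ Ioo 0 t, HasDerivAt N (-(N s * Mf' s * N s)) s := fun s hs =>
    hasDerivAt_ringInverse_comp (hMd s hs) (hunit s ⟨hs.1.le, hs.2.le⟩)
  have hN'c : ContinuousOn (fun s => -(N s * Mf' s * N s)) (Icc 0 t) := ((hNc.mul hM'c).mul hNc).neg
  have h0 : ‖N 0‖ ≤ 1 := by
    rw [hNinv]
    simp only [hMf, hX.initial, fderiv_id, ContinuousLinearMap.inverse_id]
    exact ContinuousLinearMap.norm_id_le
  -- the derivative bound `‖N'‖ ≤ ‖N‖ |∇v|₀`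
  have hbound : ∀ s ∈ Ioo 0 t, ‖-(N s * Mf' s * N s)‖ ≤ flowGradSup ω₀ X s * ‖N s‖ := by
    intro s hs
    have hs' : s ∈ Ico 0 T := ⟨hs.1.le, hs.2.trans ht.2⟩
    have hA : Mf' s = fderiv ℝ (lagrangianVelocity ω₀ (X s)) (X s α) * Mf s := by
      rw [ContinuousLinearMap.mul_def]
      exact fderiv_deriv_apply hF hs' (hX.contDiff_lagrangianVelocity hγ hω hωc hs') α
    have hcancel : Mf s * N s = 1 := Ring.mul_inverse_cancel _ (hunit s ⟨hs.1.le, hs.2.le⟩)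
    rw [norm_neg, hA, show N s * (fderiv ℝ (lagrangianVelocity ω₀ (X s)) (X s α) * Mf s) * N s =
      N s * fderiv ℝ (lagrangianVelocity ω₀ (X s)) (X s α) * (Mf s * N s) by
        simp only [mul_assoc], hcancel, mul_one]
    exact (norm_mul_le _ _).trans ((mul_le_mul_of_nonneg_left
      (hX.norm_fderiv_lagrangianVelocity_le_flowGradSup hγ hγ1 hω hωc hs' _) (norm_nonneg _)).trans
      (le_of_eq (mul_comm _ _)))
  have hineq : ∀ t' ∈ Icc 0 t, ‖N t'‖ ≤
      1 + (∫⁻ s in Ioo 0 t', ENNReal.ofReal (flowGradSup ω₀ X s * ‖N s‖)).toReal := by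
    intro t' ht'
    refine (norm_le_norm_add_toReal_lintegral_of_hasDerivAt ht'.1
      (hNc.mono (Icc_subset_Icc_right ht'.2)) (fun s hs => hNd s ⟨hs.1, hs.2.trans_le ht'.2⟩)
      ((hN'c.mono (Icc_subset_Icc_right ht'.2)).intervalIntegrable_of_Icc ht'.1)
      (g := fun s => flowGradSup ω₀ X s * ‖N s‖) (fun s hs => hbound s ⟨hs.1, hs.2.trans_le ht'.2⟩)
      ?_).trans (add_le_add h0 le_rfl)
    refine lintegral_Ioo_ofReal_ne_top_of_le (B := B * B) fun s hs => ?_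
    have hs' : s ∈ Icc 0 t := ⟨hs.1.le, hs.2.le.trans ht'.2⟩
    rw [hNinv]
    exact mul_le_mul (toReal_iSup_enorm_le (hB s hs').1) ((hB s hs').2.2.2 α) (norm_nonneg _)
      (zero_le_one.trans hB1)
  have key := real_gronwall_Icc (u := fun s => ‖N s‖) (κ := flowGradSup ω₀ X) zero_le_one
    (fun s hs => by rw [hNinv]; exact (hB s hs).2.2.2 α) (fun s _ => flowGradSup_nonneg ω₀ X s)
    (hX.lintegral_flowGradSup_ne_top hγ hγ1 hω hωc le_rfl ht.2) hineq t ⟨ht.1, le_rfl⟩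
  rw [one_mul, hNinv] at key
  exact key

include hγ1 in
/-- **The two-time deformation bound**: `‖∇_αX(α,s) (∇_αX(α,t))⁻¹‖ ≤ exp ∫ₛᵗ |∇v(·,τ)|₀ dτ`
for `0 ≤ s ≤ t < T` — the gradient of the backward flow `X(·,s) ∘ X(·,t)⁻¹` at `X(α,t)`
(p. 136: "`|∇X⁻¹(x, t−s)|_0 ≤ exp[∫ₛᵗ |∇v(s′,·)|_0 ds′]`"): `G(τ) = ∇_αX(α,s)(∇_αX(α,τ))⁻¹`
solves `G′ = −G ∇v(X,τ)`, `G(s) = I`, forward Grönwall in `τ ∈ [s, t]`. [cite: MajdaBertozziCUP2002, §4.2 proof of Lemma 4.8 (p. 136)] -/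
theorem norm_fderiv_comp_inverse_le_exp {s t : ℝ} (hs : 0 ≤ s) (hst : s ≤ t) (ht : t < T) (α : ℝ³) :
    ‖(fderiv ℝ (X s : ℝ³ → ℝ³) α).comp (fderiv ℝ (X t : ℝ³ → ℝ³) α).inverse‖ ≤
      Real.exp (flowGradInt ω₀ X s t) := by
  obtain ⟨X', hc, hd, hF⟩ := hX.hasDeriv
  obtain ⟨B, hB1, hB⟩ := hX.exists_flow_bounds hγ hγ1 hω hωc ht
  set Mf : ℝ → ℝ³ →L[ℝ] ℝ³ := fun τ => fderiv ℝ (X τ : ℝ³ → ℝ³) α with hMf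
  set Mf' : ℝ → ℝ³ →L[ℝ] ℝ³ := fun τ => fderiv ℝ (X' τ : ℝ³ → ℝ³) α with hMf'
  set N : ℝ → ℝ³ →L[ℝ] ℝ³ := fun τ => Ring.inverse (Mf τ) with hN
  set G : ℝ → ℝ³ →L[ℝ] ℝ³ := fun τ => Mf s * N τ with hG
  have hNinv : ∀ τ, N τ = (Mf τ).inverse := fun τ => by
    rw [hN]; simp only; rw [ContinuousLinearMap.ringInverse_eq_inverse]
  have hMc : ContinuousOn Mf (Icc 0 t) :=
    (C1HolderMap.continuous_fderiv_apply α).comp_continuousOn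
      (hX.continuousOn.mono (Icc_subset_Ico_right ht))
  have hM'c : ContinuousOn Mf' (Icc 0 t) :=
    (C1HolderMap.continuous_fderiv_apply α).comp_continuousOn (hc.mono (Icc_subset_Ico_right ht))
  have hMd : ∀ τ ∈ Ioo 0 t, HasDerivAt Mf (Mf' τ) τ := fun τ hτ =>
    (hasDerivWithinAt_fderiv_apply (hd τ ⟨hτ.1.le, hτ.2.trans ht⟩) α).hasDerivAt
      (Ico_mem_nhds hτ.1 (hτ.2.trans ht))
  have hunit : ∀ τ ∈ Icc 0 t, IsUnit (Mf τ) := fun τ hτ => hX.isUnit_fderiv ⟨hτ.1, hτ.2.trans_lt ht⟩ α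
  have hNc : ContinuousOn N (Icc 0 t) := by
    intro τ hτ
    obtain ⟨u, hu⟩ := hunit τ hτ
    have h1 : ContinuousAt Ring.inverse (Mf τ) := hu ▸ NormedRing.inverse_continuousAt u
    exact h1.comp_continuousWithinAt (hMc τ hτ)
  have hNd : ∀ τ ∈ Ioo 0 t, HasDerivAt N (-(N τ * Mf' τ * N τ)) τ := fun τ hτ =>
    hasDerivAt_ringInverse_comp (hMd τ hτ) (hunit τ ⟨hτ.1.le, hτ.2.le⟩)
  -- `G` on `[s, t]`
  have hsI : Icc s t ⊆ Icc 0 t := Icc_subset_Icc_left hs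
  have hGc : ContinuousOn G (Icc s t) := (continuousOn_const.mul hNc).mono hsI
  have hGd : ∀ τ ∈ Ioo s t, HasDerivAt G (Mf s * -(N τ * Mf' τ * N τ)) τ := fun τ hτ =>
    (hNd τ ⟨hs.trans_lt hτ.1, hτ.2⟩).const_mul (Mf s)
  have hG'c : ContinuousOn (fun τ => Mf s * -(N τ * Mf' τ * N τ)) (Icc s t) :=
    (continuousOn_const.mul ((hNc.mul hM'c).mul hNc).neg).mono hsI
  have hGs : ‖G s‖ ≤ 1 := by
    show ‖Mf s * Ring.inverse (Mf s)‖ ≤ 1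
    rw [Ring.mul_inverse_cancel _ (hunit s ⟨hs, hst⟩), ContinuousLinearMap.one_def]
    exact ContinuousLinearMap.norm_id_le
  have hbound : ∀ τ ∈ Ioo s t, ‖Mf s * -(N τ * Mf' τ * N τ)‖ ≤ flowGradSup ω₀ X τ * ‖G τ‖ := by
    intro τ hτ
    have hτ' : τ ∈ Ico 0 T := ⟨hs.trans hτ.1.le, hτ.2.trans ht⟩
    have hA : Mf' τ = fderiv ℝ (lagrangianVelocity ω₀ (X τ)) (X τ α) * Mf τ := by
      rw [ContinuousLinearMap.mul_def]
      exact fderiv_deriv_apply hF hτ' (hX.contDiff_lagrangianVelocity hγ hω hωc hτ') α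
    have hcancel : Mf τ * N τ = 1 :=
      Ring.mul_inverse_cancel _ (hunit τ ⟨hs.trans hτ.1.le, hτ.2.le⟩)
    have hrw : Mf s * -(N τ * Mf' τ * N τ) =
        -(G τ * fderiv ℝ (lagrangianVelocity ω₀ (X τ)) (X τ α)) := by
      have hc' : ∀ v, Mf τ (N τ v) = v := fun v => by
        have h := congrArg (fun L : ℝ³ →L[ℝ] ℝ³ => L v) hcancel
        simpa using h
      rw [hA, hG]
      ext v
      simp [hc']
    rw [hrw, norm_neg]
    exact (norm_mul_le _ _).trans ((mul_le_mul_of_nonneg_left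
      (hX.norm_fderiv_lagrangianVelocity_le_flowGradSup hγ hγ1 hω hωc hτ' _) (norm_nonneg _)).trans
      (le_of_eq (mul_comm _ _)))
  have hGB : ∀ τ ∈ Icc s t, ‖G τ‖ ≤ B * B := fun τ hτ =>
    (norm_mul_le _ _).trans (mul_le_mul ((hB s ⟨hs, hst⟩).2.2.1 α)
      (by rw [hNinv]; exact (hB τ (hsI hτ)).2.2.2 α) (norm_nonneg _) (zero_le_one.trans hB1))
  have hineq : ∀ t' ∈ Icc s t, ‖G t'‖ ≤
      1 + (∫⁻ τ in Ioo s t', ENNReal.ofReal (flowGradSup ω₀ X τ * ‖G τ‖)).toReal := by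
    intro t' ht'
    refine (norm_le_norm_add_toReal_lintegral_of_hasDerivAt ht'.1
      (hGc.mono (Icc_subset_Icc_right ht'.2)) (fun τ hτ => hGd τ ⟨hτ.1, hτ.2.trans_le ht'.2⟩)
      ((hG'c.mono (Icc_subset_Icc_right ht'.2)).intervalIntegrable_of_Icc ht'.1)
      (g := fun τ => flowGradSup ω₀ X τ * ‖G τ‖) (fun τ hτ => hbound τ ⟨hτ.1, hτ.2.trans_le ht'.2⟩)
      ?_).trans (add_le_add hGs le_rfl)
    refine lintegral_Ioo_ofReal_ne_top_of_le (B := B * (B * B)) fun τ hτ => ?_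
    have hτ' : τ ∈ Icc 0 t := ⟨hs.trans hτ.1.le, hτ.2.le.trans ht'.2⟩
    exact mul_le_mul (toReal_iSup_enorm_le (hB τ hτ').1) (hGB τ ⟨hτ.1.le, hτ.2.le.trans ht'.2⟩)
      (norm_nonneg _) (zero_le_one.trans hB1)
  have key := real_gronwall_Icc (u := fun τ => ‖G τ‖) (κ := flowGradSup ω₀ X) zero_le_one
    hGB (fun τ _ => flowGradSup_nonneg ω₀ X τ)
    (hX.lintegral_flowGradSup_ne_top hγ hγ1 hω hωc hs ht) hineq t ⟨hst, le_rfl⟩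
  rw [one_mul] at key
  have hGt : G t = (fderiv ℝ (X s : ℝ³ → ℝ³) α).comp (fderiv ℝ (X t : ℝ³ → ℝ³) α).inverse := by
    show Mf s * N t = _
    rw [hNinv, ContinuousLinearMap.mul_def]
  rw [hGt] at key
  exact key

include hγ1 in
/-- **Lipschitz bound of the backward flow** `X(·,s) ∘ X(·,t)⁻¹` for `0 ≤ s ≤ t < T`:
`‖X(α,s) − X(β,s)‖ ≤ exp(∫ₛᵗ |∇v(·,τ)|₀ dτ) ‖X(α,t) − X(β,t)‖` (the map is `C¹` with gradient
`∇_αX(a,s)(∇_αX(a,t))⁻¹`, `a = X⁻¹(x,t)`, bounded by the previous theorem; mean value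
inequality). This pulls Hölder quotients at time `t` back to labels/earlier times in the proof
of Lemma 4.8 (p. 135–136). For `s = 0` it is the Lipschitz bound of `X(·,t)⁻¹`. [cite: MajdaBertozziCUP2002, §4.2 proof of Lemma 4.8 (p. 135–136)] -/
theorem norm_apply_sub_apply_le_exp {s t : ℝ} (hs : 0 ≤ s) (hst : s ≤ t) (ht : t < T) (α β : ℝ³) :
    ‖X s α - X s β‖ ≤ Real.exp (flowGradInt ω₀ X s t) * ‖X t α - X t β‖ := by
  have ht' : t ∈ Ico 0 T := ⟨hs.trans hst, ht⟩
  have hbij := hX.bijective t ht'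
  have hdet' : ∀ a, (fderiv ℝ (X t : ℝ³ → ℝ³) a).det ≠ 0 := fun a => by
    rw [hX.volumePreserving t ht' a]; exact one_ne_zero
  set Φ : ℝ³ → ℝ³ := (X s : ℝ³ → ℝ³) ∘ Function.invFun (X t : ℝ³ → ℝ³) with hΦ
  have hΦd : ∀ x, HasFDerivAt Φ ((fderiv ℝ (X s : ℝ³ → ℝ³) (Function.invFun (X t : ℝ³ → ℝ³) x)).comp
      (fderiv ℝ (X t : ℝ³ → ℝ³) (Function.invFun (X t : ℝ³ → ℝ³) x)).inverse) x := fun x =>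
    ((X s).differentiable _).hasFDerivAt.comp x
      (hasFDerivAt_invFun_of_det_fderiv_ne_zero (X t).contDiff hbij hdet' x)
  have hmv := (convex_univ (𝕜 := ℝ) (E := ℝ³)).norm_image_sub_le_of_norm_hasFDerivWithin_le
    (f := Φ) (fun x _ => (hΦd x).hasFDerivWithinAt)
    (fun x _ => hX.norm_fderiv_comp_inverse_le_exp hγ hγ1 hω hωc hs hst ht _)
    (mem_univ (X t β)) (mem_univ (X t α))
  have hΦα : Φ (X t α) = X s α := by
    simp only [hΦ, Function.comp_apply, Function.leftInverse_invFun hbij.1 α]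
  have hΦβ : Φ (X t β) = X s β := by
    simp only [hΦ, Function.comp_apply, Function.leftInverse_invFun hbij.1 β]
  rwa [hΦα, hΦβ] at hmv

include hγ1 in
/-- **Lipschitz bound of the inverse trajectory map**: `‖α − β‖ ≤ exp(∫₀ᵗ |∇v|₀) ‖X(α,t) − X(β,t)‖`
(`X(·, 0) = id`). [cite: MajdaBertozziCUP2002, §4.2 proof of Lemma 4.8 (p. 136)] -/
theorem norm_sub_le_exp_mul {t : ℝ} (ht : t ∈ Ico 0 T) (α β : ℝ³) :
    ‖α - β‖ ≤ Real.exp (flowGradInt ω₀ X 0 t) * ‖X t α - X t β‖ := by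
  have h := hX.norm_apply_sub_apply_le_exp hγ hγ1 hω hωc le_rfl ht.1 ht.2 α β
  rwa [hX.initial] at h

/-! #### (4.46): displacement bound -/

include hγ1 in
/-- **(4.46)** "`|X(0,t)| ≤ ∫₀ᵗ |v(·, s)|_0 ds`", for every label:
`‖X(α,t) − α‖ ≤ ∫₀ᵗ sup_x ‖v(x,s)‖ ds` (lower integral of the suprema; (4.44) integrated). [cite: MajdaBertozziCUP2002, §4.2 (4.46) (p. 133)] -/
theorem norm_apply_sub_self_le {t : ℝ} (ht : t ∈ Ico 0 T) (α : ℝ³) :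
    ‖X t α - α‖ ≤ (∫⁻ s in Ioo 0 t, ⨆ x, ‖lagrangianVelocity ω₀ (X s) x‖ₑ).toReal := by
  obtain ⟨X', hc, hd, hF⟩ := hX.hasDeriv
  obtain ⟨B, -, hB⟩ := hX.exists_flow_bounds hγ hγ1 hω hωc ht.2
  set Mf : ℝ → ℝ³ := fun s => X s α - α with hMf
  set Mf' : ℝ → ℝ³ := fun s => X' s α with hMf'
  have hMc : ContinuousOn Mf (Icc 0 t) :=
    (((C1HolderMap.evalCLM (r := γ) (F := ℝ³) α).continuous.comp_continuousOn
      (hX.continuousOn.mono (Icc_subset_Ico_right ht.2))).sub continuousOn_const)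
  have hM'c : ContinuousOn Mf' (Icc 0 t) :=
    (C1HolderMap.evalCLM (r := γ) (F := ℝ³) α).continuous.comp_continuousOn
      (hc.mono (Icc_subset_Ico_right ht.2))
  have hMd : ∀ s ∈ Ioo 0 t, HasDerivAt Mf (Mf' s) s := by
    intro s hs
    have hs' : s ∈ Ico 0 T := ⟨hs.1.le, hs.2.trans ht.2⟩
    have h1 : HasDerivWithinAt (fun τ => C1HolderMap.evalCLM α (X τ))
        (C1HolderMap.evalCLM α (X' s)) (Ico 0 T) s :=
      (C1HolderMap.evalCLM α).hasFDerivAt.comp_hasDerivWithinAt s (hd s hs')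
    simp only [C1HolderMap.evalCLM_apply] at h1
    exact (h1.hasDerivAt (Ico_mem_nhds hs.1 (hs.2.trans ht.2))).sub_const α
  have h0 : ‖Mf 0‖ = 0 := by simp [hMf, hX.initial]
  set g : ℝ → ℝ := fun s => (⨆ x, ‖lagrangianVelocity ω₀ (X s) x‖ₑ).toReal with hg
  have h := norm_le_norm_add_toReal_lintegral_of_hasDerivAt ht.1 hMc hMd
    (hM'c.intervalIntegrable_of_Icc ht.1) (g := g) (fun s hs => ?_) ?_
  · rw [h0, zero_add] at h
    refine h.trans (le_of_eq ?_)
    congr 1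
    refine setLIntegral_congr_fun measurableSet_Ioo fun s hs => ?_
    exact ofReal_toReal_iSup_enorm (hB s ⟨hs.1.le, hs.2.le⟩).2.1
  · have hs' : s ∈ Ico 0 T := ⟨hs.1.le, hs.2.trans ht.2⟩
    show ‖X' s α‖ ≤ g s
    rw [hF s hs' α]
    exact norm_le_toReal_iSup_enorm (hB s ⟨hs.1.le, hs.2.le⟩).2.1 (X s α)
  · exact lintegral_Ioo_ofReal_ne_top_of_le fun s hs => toReal_iSup_enorm_le (hB s ⟨hs.1.le, hs.2.le⟩).2.1

/-! #### Integral inequalities for label differences (towards the Hölder seminorms) -/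

/-- **The integral inequality for `∇_αX(α,t) − ∇_αX(β,t)`** (p. 134, first display: the Hölder
seminorm of `∇_αX` is controlled by integrating (4.45) in time): if
`‖∇v(X(α,s),s)∇_αX(α,s) − ∇v(X(β,s),s)∇_αX(β,s)‖ ≤ g(s)` on `(0, t)` with `g` bounded, then
`‖∇_αX(α,t) − ∇_αX(β,t)‖ ≤ ∫_{(0,t)} g`. [cite: MajdaBertozziCUP2002, §4.2 proof of Prop. 4.3 (p. 134)] -/
theorem norm_fderiv_sub_fderiv_le_lintegral {t : ℝ} (ht : t ∈ Ico 0 T) (α β : ℝ³) {g : ℝ → ℝ}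
    {B' : ℝ}
    (hg : ∀ s ∈ Ioo 0 t, ‖(fderiv ℝ (lagrangianVelocity ω₀ (X s)) (X s α)).comp
        (fderiv ℝ (X s : ℝ³ → ℝ³) α) - (fderiv ℝ (lagrangianVelocity ω₀ (X s)) (X s β)).comp
        (fderiv ℝ (X s : ℝ³ → ℝ³) β)‖ ≤ g s)
    (hgB : ∀ s ∈ Ioo 0 t, g s ≤ B') :
    ‖fderiv ℝ (X t : ℝ³ → ℝ³) α - fderiv ℝ (X t : ℝ³ → ℝ³) β‖ ≤
      (∫⁻ s in Ioo 0 t, ENNReal.ofReal (g s)).toReal := by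
  obtain ⟨X', hc, hd, hF⟩ := hX.hasDeriv
  set Mf : ℝ → ℝ³ →L[ℝ] ℝ³ := fun s => fderiv ℝ (X s : ℝ³ → ℝ³) α - fderiv ℝ (X s : ℝ³ → ℝ³) β
    with hMf
  set Mf' : ℝ → ℝ³ →L[ℝ] ℝ³ := fun s => fderiv ℝ (X' s : ℝ³ → ℝ³) α - fderiv ℝ (X' s : ℝ³ → ℝ³) β
    with hMf'
  have hsub : Icc 0 t ⊆ Ico 0 T := Icc_subset_Ico_right ht.2
  have hMc : ContinuousOn Mf (Icc 0 t) :=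
    ((C1HolderMap.continuous_fderiv_apply α).comp_continuousOn (hX.continuousOn.mono hsub)).sub
      ((C1HolderMap.continuous_fderiv_apply β).comp_continuousOn (hX.continuousOn.mono hsub))
  have hM'c : ContinuousOn Mf' (Icc 0 t) :=
    ((C1HolderMap.continuous_fderiv_apply α).comp_continuousOn (hc.mono hsub)).sub
      ((C1HolderMap.continuous_fderiv_apply β).comp_continuousOn (hc.mono hsub))
  have hMd : ∀ s ∈ Ioo 0 t, HasDerivAt Mf (Mf' s) s := fun s hs =>
    ((hasDerivWithinAt_fderiv_apply (hd s ⟨hs.1.le, hs.2.trans ht.2⟩) α).sub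
      (hasDerivWithinAt_fderiv_apply (hd s ⟨hs.1.le, hs.2.trans ht.2⟩) β)).hasDerivAt
      (Ico_mem_nhds hs.1 (hs.2.trans ht.2))
  have h0 : ‖Mf 0‖ = 0 := by simp [hMf, hX.initial]
  have h := norm_le_norm_add_toReal_lintegral_of_hasDerivAt ht.1 hMc hMd
    (hM'c.intervalIntegrable_of_Icc ht.1) (g := g) (fun s hs => ?_)
    (lintegral_Ioo_ofReal_ne_top_of_le hgB)
  · rwa [h0, zero_add] at h
  · have hs' : s ∈ Ico 0 T := ⟨hs.1.le, hs.2.trans ht.2⟩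
    have hv := hX.contDiff_lagrangianVelocity hγ hω hωc hs'
    show ‖fderiv ℝ (X' s : ℝ³ → ℝ³) α - fderiv ℝ (X' s : ℝ³ → ℝ³) β‖ ≤ g s
    rw [fderiv_deriv_apply hF hs' hv α, fderiv_deriv_apply hF hs' hv β]
    exact hg s hs

/-- **The integral inequality for the transported vectors `∇_αX(α,t) e`** (towards Lemma 4.8 in
labels: `W(α,t) = ∇_αX(α,t) ω₀(α) = ω(X(α,t),t)` solves `W′ = ∇v(X,t) W`, so
`‖W(α,t) − W(β,t)‖ ≤ ‖W(α,0) − W(β,0)‖ + ∫₀ᵗ ‖(ω·∇v)(X(α,s),s) − (ω·∇v)(X(β,s),s)‖ ds`, p. 135):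
if `‖∇v(X(α,s),s)(∇_αX(α,s) e) − ∇v(X(β,s),s)(∇_αX(β,s) e′)‖ ≤ g(s)` on `(0, t)` with `g`
bounded, then `‖∇_αX(α,t) e − ∇_αX(β,t) e′‖ ≤ ‖e − e′‖ + ∫_{(0,t)} g`. [cite: MajdaBertozziCUP2002, §4.2 proof of Lemma 4.8 (p. 135–136)] -/
theorem norm_fderiv_apply_sub_le_lintegral {t : ℝ} (ht : t ∈ Ico 0 T) (α β e e' : ℝ³)
    {g : ℝ → ℝ} {B' : ℝ}
    (hg : ∀ s ∈ Ioo 0 t, ‖fderiv ℝ (lagrangianVelocity ω₀ (X s)) (X s α)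
        (fderiv ℝ (X s : ℝ³ → ℝ³) α e) - fderiv ℝ (lagrangianVelocity ω₀ (X s)) (X s β)
        (fderiv ℝ (X s : ℝ³ → ℝ³) β e')‖ ≤ g s)
    (hgB : ∀ s ∈ Ioo 0 t, g s ≤ B') :
    ‖fderiv ℝ (X t : ℝ³ → ℝ³) α e - fderiv ℝ (X t : ℝ³ → ℝ³) β e'‖ ≤
      ‖e - e'‖ + (∫⁻ s in Ioo 0 t, ENNReal.ofReal (g s)).toReal := by
  obtain ⟨X', hc, hd, hF⟩ := hX.hasDeriv
  set Mf : ℝ → ℝ³ := fun s => fderiv ℝ (X s : ℝ³ → ℝ³) α e - fderiv ℝ (X s : ℝ³ → ℝ³) β e'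
    with hMf
  set Mf' : ℝ → ℝ³ := fun s => fderiv ℝ (X' s : ℝ³ → ℝ³) α e - fderiv ℝ (X' s : ℝ³ → ℝ³) β e'
    with hMf'
  have hsub : Icc 0 t ⊆ Ico 0 T := Icc_subset_Ico_right ht.2
  have hMc : ContinuousOn Mf (Icc 0 t) :=
    (((C1HolderMap.continuous_fderiv_apply α).clm_apply continuous_const).comp_continuousOn
      (hX.continuousOn.mono hsub)).sub
      (((C1HolderMap.continuous_fderiv_apply β).clm_apply continuous_const).comp_continuousOn
        (hX.continuousOn.mono hsub))
  have hM'c : ContinuousOn Mf' (Icc 0 t) :=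
    (((C1HolderMap.continuous_fderiv_apply α).clm_apply continuous_const).comp_continuousOn
      (hc.mono hsub)).sub
      (((C1HolderMap.continuous_fderiv_apply β).clm_apply continuous_const).comp_continuousOn
        (hc.mono hsub))
  have hMd : ∀ s ∈ Ioo 0 t, HasDerivAt Mf (Mf' s) s := by
    intro s hs
    have hs' : s ∈ Ico 0 T := ⟨hs.1.le, hs.2.trans ht.2⟩
    have hα := ((hasDerivWithinAt_fderiv_apply (hd s hs') α).hasDerivAt
      (Ico_mem_nhds hs.1 (hs.2.trans ht.2))).clm_apply (hasDerivAt_const s e)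
    have hβ := ((hasDerivWithinAt_fderiv_apply (hd s hs') β).hasDerivAt
      (Ico_mem_nhds hs.1 (hs.2.trans ht.2))).clm_apply (hasDerivAt_const s e')
    simp only [map_zero, add_zero] at hα hβ
    exact hα.sub hβ
  have h0 : ‖Mf 0‖ = ‖e - e'‖ := by simp [hMf, hX.initial]
  have h := norm_le_norm_add_toReal_lintegral_of_hasDerivAt ht.1 hMc hMd
    (hM'c.intervalIntegrable_of_Icc ht.1) (g := g) (fun s hs => ?_)
    (lintegral_Ioo_ofReal_ne_top_of_le hgB)
  · rwa [h0] at h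
  · have hs' : s ∈ Ico 0 T := ⟨hs.1.le, hs.2.trans ht.2⟩
    have hv := hX.contDiff_lagrangianVelocity hγ hω hωc hs'
    show ‖fderiv ℝ (X' s : ℝ³ → ℝ³) α e - fderiv ℝ (X' s : ℝ³ → ℝ³) β e'‖ ≤ g s
    rw [fderiv_deriv_apply hF hs' hv α, fderiv_deriv_apply hF hs' hv β]
    exact hg s hs


end IsParticleTrajectorySolution

end Flow

end Literature.Analysis.FluidPDE
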